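import Literature.NumberTheory.GaloisRepresentations.AdequacyDegreeP
import HarnessLib

/-!
# The `S₄` branch-point module over `𝔽₃` is adequate (an instance of GHT 2017, Prop. 6.6)

Topic `NumberTheory/GaloisRepresentations`, a sibling of `AdequacyDegreeP.lean` (Guralnick–Herzig–
Tiep 2017, Thm 1.7 as a named fact, and its imprimitive case Prop. 6.6 PROVED there).  This file
settles, unconditionally and without the classification of finite simple groups, the INSTANCE of
Theorem 1.7 that the tree wants (work item wi-37170, line `thorne-minimal-lift` of crux
`MuOrdinaryFamilyRT`): `G = S₄` acting on the branch-point module `V = 𝔽₃⁴/Δ` of a generic Picard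
curve, `p = 3 = dim V`, is adequate in the extended sense of GHT §1 = Thorne 2017 Def. 2.20
(`Subgroup.IsExtendedAdequate`).

Model.  In the basis of `V ≅ {x ∈ 𝔽₃⁴ | ∑ xᵢ = 0}` given by the three "pairing vectors"
`u₁ = e₁+e₂−e₃−e₄`, `u₂ = e₁−e₂+e₃−e₄`, `u₃ = e₁−e₂−e₃+e₄` (one for each pairing `{12|34}`,
`{13|24}`, `{14|23}`), `S₄` acts by signed permutation matrices: it is the monomial group
`V₄ ⋊ S₃ < GL₁(𝔽₃) ≀ S₃`, generated by the images `genT` of `(1 2)` and `genC` of `(1 2 3 4)`;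
`s4Image := closure {genT, genC} ≤ GL₃(𝔽₃)`.

Proof (`s4Image_isExtendedAdequate`): `Subgroup.isExtendedAdequate_of_lines` (GHT Prop. 6.6 in
the form with hypotheses on the lines) applied to the standard basis: every element of `s4Image`
maps each `eᵢ` to `± eⱼ` (`exists_mulVec_single_eq`, by closure induction); `(1 2)(3 4)` acts as
`diag(1, −1, −1)` (two distinct eigenvalues: `A = V₄` is not central); `(1 2)` fixes the line of
`u₁` and moves that of `u₂` (`|G/A| = 6 ≠ 3`); and `V` is irreducible (`isIrreducible`: a
non-zero stable subspace contains some `v + D v = 2 vᵢ eᵢ`, `D ∈ V₄` diagonal, hence all `eⱼ`).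
What is NOT recorded: an isomorphism `s4Image ≃* S₄` (not needed), and the identification of this
model with other models of the branch-point module (a user with another basis applies
`Subgroup.isExtendedAdequate_of_lines` in the same way, or conjugates).

## References

* [GuralnickHerzigTiep2017] Guralnick–Herzig–Tiep, JEMS 19 (2017), Thm 1.7, Prop. 6.6.
* [Thorne2017TwoAdic] J. Thorne, Math. Z. 285 (2017), Def. 2.20 (the notion of adequacy).
-/

namespace Literature.NumberTheory.GaloisRepresentations

open scoped MatrixGroups Matrix

namespace S4BranchModule

/-- The transposition `(1 2)` of `S₄` on the reduced permutation module `𝔽₃⁴/Δ ≅ {∑ xᵢ = 0}`, in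
the basis of the three "pairing vectors" `u₁ = e₁+e₂−e₃−e₄`, `u₂ = e₁−e₂+e₃−e₄`,
`u₃ = e₁−e₂−e₃+e₄`: `u₁ ↦ u₁`, `u₂ ↦ −u₃`, `u₃ ↦ −u₂` (an involution). [folklore] -/
def genT : GL (Fin 3) (ZMod 3) :=
  ⟨!![1, 0, 0; 0, 0, -1; 0, -1, 0], !![1, 0, 0; 0, 0, -1; 0, -1, 0], by decide, by decide⟩

/-- The `4`-cycle `(1 2 3 4)` of `S₄` in the pairing basis: `u₁ ↦ −u₃`, `u₂ ↦ −u₂`, `u₃ ↦ u₁`.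
[folklore] -/
def genC : GL (Fin 3) (ZMod 3) :=
  ⟨!![0, 0, 1; 0, -1, 0; -1, 0, 0], !![0, 0, -1; 0, -1, 0; 1, 0, 0], by decide, by decide⟩

/-- The image of `S₄ = ⟨(1 2), (1 2 3 4)⟩` in `GL₃(𝔽₃)` on the branch-point module `𝔽₃⁴/Δ`
(pairing basis): the monomial group `V₄ ⋊ S₃ < GL₁(𝔽₃) ≀ S₃`. [folklore] -/
def s4Image : Subgroup (GL (Fin 3) (ZMod 3)) := Subgroup.closure {genT, genC}

/-- `(1 2) ∈ S₄`. [folklore] -/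
theorem genT_mem : genT ∈ s4Image := Subgroup.subset_closure (Set.mem_insert _ _)

/-- `(1 2 3 4) ∈ S₄`. [folklore] -/
theorem genC_mem : genC ∈ s4Image :=
  Subgroup.subset_closure (Set.mem_insert_of_mem _ (Set.mem_singleton _))

/-- **`S₄` permutes the three pairing lines** (it is a monomial group in the pairing basis): every
element maps each basis vector to a multiple of a basis vector. [folklore] -/
theorem exists_mulVec_single_eq (g : GL (Fin 3) (ZMod 3)) (hg : g ∈ s4Image) (i : Fin 3) :
    ∃ (j : Fin 3) (c : ZMod 3), (g : Matrix (Fin 3) (Fin 3) (ZMod 3)) *ᵥ Pi.single i 1 =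
      c • Pi.single j 1 := by
  have key : ∀ g : GL (Fin 3) (ZMod 3), g ∈ s4Image →
      (∀ i : Fin 3, ∃ (j : Fin 3) (c : ZMod 3), (g : Matrix (Fin 3) (Fin 3) (ZMod 3)) *ᵥ
        Pi.single i 1 = c • Pi.single j 1) ∧
      (∀ i : Fin 3, ∃ (j : Fin 3) (c : ZMod 3), ((g⁻¹ : GL (Fin 3) (ZMod 3)) : Matrix (Fin 3)
        (Fin 3) (ZMod 3)) *ᵥ Pi.single i 1 = c • Pi.single j 1) := by
    intro g hg
    refine Subgroup.closure_induction (p := fun (g : GL (Fin 3) (ZMod 3)) _ =>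
      (∀ i : Fin 3, ∃ (j : Fin 3) (c : ZMod 3),
        (g : Matrix (Fin 3) (Fin 3) (ZMod 3)) *ᵥ Pi.single i 1 = c • Pi.single j 1) ∧
      (∀ i : Fin 3, ∃ (j : Fin 3) (c : ZMod 3), ((g⁻¹ : GL (Fin 3) (ZMod 3)) : Matrix (Fin 3)
        (Fin 3) (ZMod 3)) *ᵥ Pi.single i 1 = c • Pi.single j 1)) ?_ ?_ ?_ ?_ hg
    · rintro x hx
      rcases hx with rfl | hx
      · exact ⟨by decide, by decide⟩
      · rw [Set.mem_singleton_iff] at hx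
        subst hx
        exact ⟨by decide, by decide⟩
    · refine ⟨fun i => ⟨i, 1, ?_⟩, fun i => ⟨i, 1, ?_⟩⟩
      · rw [Units.val_one, Matrix.one_mulVec, one_smul]
      · rw [inv_one, Units.val_one, Matrix.one_mulVec, one_smul]
    · rintro x y _ _ ⟨hx, hx'⟩ ⟨hy, hy'⟩
      constructor
      · intro i
        obtain ⟨j, c, hj⟩ := hy i
        obtain ⟨j', c', hj'⟩ := hx j
        refine ⟨j', c * c', ?_⟩
        rw [Units.val_mul, ← Matrix.mulVec_mulVec, hj, Matrix.mulVec_smul, hj', smul_smul]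
      · intro i
        obtain ⟨j, c, hj⟩ := hx' i
        obtain ⟨j', c', hj'⟩ := hy' j
        refine ⟨j', c * c', ?_⟩
        rw [mul_inv_rev, Units.val_mul, ← Matrix.mulVec_mulVec, hj, Matrix.mulVec_smul, hj',
          smul_smul]
    · rintro x _ ⟨hx, hx'⟩
      refine ⟨hx', ?_⟩
      rw [inv_inv]
      exact hx
  exact (key g hg).1 i

/-- **`S₄` is irreducible on the branch-point module over `𝔽₃`.**  A non-zero stable subspace
contains, with `v`, the vector `v + D_i v = 2 v_i e_i` for the three diagonal elements
`D_i ∈ V₄` (`+1` at `i`, `−1` elsewhere), hence some `e_i`, hence all of them through `(1 2)` and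
`(1 2 3 4)`. [folklore] -/
theorem isIrreducible : (glRepresentation s4Image.subtype).IsIrreducible := by
  classical
  -- three diagonal elements of `V₄`
  have hD0 : genT * (genC ^ 2 * genT * genC ^ 2) ∈ s4Image :=
    s4Image.mul_mem genT_mem (s4Image.mul_mem (s4Image.mul_mem (s4Image.pow_mem genC_mem 2)
      genT_mem) (s4Image.pow_mem genC_mem 2))
  have hD2 : genC * (genT * (genC ^ 2 * genT * genC ^ 2)) * genC⁻¹ ∈ s4Image :=
    s4Image.mul_mem (s4Image.mul_mem genC_mem hD0) (s4Image.inv_mem genC_mem)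
  have hD1 : genT * (genC ^ 2 * genT * genC ^ 2) *
      (genC * (genT * (genC ^ 2 * genT * genC ^ 2)) * genC⁻¹) ∈ s4Image :=
    s4Image.mul_mem hD0 hD2
  have hmat0 : ((genT * (genC ^ 2 * genT * genC ^ 2) : GL (Fin 3) (ZMod 3)) :
      Matrix (Fin 3) (Fin 3) (ZMod 3)) = Matrix.diagonal ![1, -1, -1] := by decide
  have hmat2 : ((genC * (genT * (genC ^ 2 * genT * genC ^ 2)) * genC⁻¹ : GL (Fin 3) (ZMod 3)) :
      Matrix (Fin 3) (Fin 3) (ZMod 3)) = Matrix.diagonal ![-1, -1, 1] := by decide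
  have hmat1 : ((genT * (genC ^ 2 * genT * genC ^ 2) *
      (genC * (genT * (genC ^ 2 * genT * genC ^ 2)) * genC⁻¹) : GL (Fin 3) (ZMod 3)) :
      Matrix (Fin 3) (Fin 3) (ZMod 3)) = Matrix.diagonal ![-1, 1, -1] := by decide
  -- for each `i`, a diagonal element `D ∈ S₄` with `v + D v = 2 v_i e_i`
  have hdiag : ∀ i : Fin 3, ∃ D ∈ s4Image, ∀ v : Fin 3 → ZMod 3,
      v + (D : Matrix (Fin 3) (Fin 3) (ZMod 3)) *ᵥ v = (2 * v i) • Pi.single i 1 := by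
    intro i
    fin_cases i
    · refine ⟨_, hD0, fun v => ?_⟩
      rw [hmat0]
      ext j; fin_cases j <;> simp [Matrix.mulVec_diagonal]
      ring
    · refine ⟨_, hD1, fun v => ?_⟩
      rw [hmat1]
      ext j; fin_cases j <;> simp [Matrix.mulVec_diagonal]
      ring
    · refine ⟨_, hD2, fun v => ?_⟩
      rw [hmat2]
      ext j; fin_cases j <;> simp [Matrix.mulVec_diagonal]
      ring
  -- the generators move the lines around
  have hC0 : (genC : Matrix (Fin 3) (Fin 3) (ZMod 3)) *ᵥ Pi.single 0 1 = -Pi.single 2 1 := by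
    decide
  have hC2 : (genC : Matrix (Fin 3) (Fin 3) (ZMod 3)) *ᵥ Pi.single 2 1 = Pi.single 0 1 := by
    decide
  have hT1 : (genT : Matrix (Fin 3) (Fin 3) (ZMod 3)) *ᵥ Pi.single 1 1 = -Pi.single 2 1 := by
    decide
  have hT2 : (genT : Matrix (Fin 3) (Fin 3) (ZMod 3)) *ᵥ Pi.single 2 1 = -Pi.single 1 1 := by
    decide
  refine { toNontrivial := ⟨⟨⊥, ⊤, fun hbt => ?_⟩⟩, eq_bot_or_eq_top := fun W => ?_ }
  · have h := congrArg Subrepresentation.toSubmodule hbt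
    have h1 : (Pi.single 0 1 : Fin 3 → ZMod 3) ∈
        (⊤ : Subrepresentation (glRepresentation s4Image.subtype)).toSubmodule := Submodule.mem_top
    rw [← h] at h1
    change (Pi.single 0 1 : Fin 3 → ZMod 3) ∈ (⊥ : Submodule (ZMod 3) (Fin 3 → ZMod 3)) at h1
    rw [Submodule.mem_bot] at h1
    exact absurd (congrFun h1 0) (by decide)
  · by_cases hW : W = ⊥
    · exact Or.inl hW
    right
    have hmem : ∀ (x : GL (Fin 3) (ZMod 3)) (_ : x ∈ s4Image) (w : Fin 3 → ZMod 3),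
        w ∈ W.toSubmodule → (x : Matrix (Fin 3) (Fin 3) (ZMod 3)) *ᵥ w ∈ W.toSubmodule :=
      fun x hx w hw => W.apply_mem_toSubmodule ⟨x, hx⟩ hw
    -- a non-zero vector of `W`
    have hne : W.toSubmodule ≠ ⊥ := fun h =>
      hW (Subrepresentation.toSubmodule_injective (by rw [h]; rfl))
    obtain ⟨v, hv, hv0⟩ := (Submodule.ne_bot_iff _).1 hne
    obtain ⟨i, hi⟩ := Function.ne_iff.1 hv0
    -- some `e_i ∈ W`
    have hei : (Pi.single i 1 : Fin 3 → ZMod 3) ∈ W.toSubmodule := by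
      obtain ⟨D, hD, hDv⟩ := hdiag i
      have h1 : v + (D : Matrix (Fin 3) (Fin 3) (ZMod 3)) *ᵥ v ∈ W.toSubmodule :=
        W.toSubmodule.add_mem hv (hmem D hD v hv)
      rw [hDv] at h1
      have h2 : (2 * v i) ≠ 0 := mul_ne_zero (by decide) hi
      have h3 := W.toSubmodule.smul_mem (2 * v i)⁻¹ h1
      rwa [smul_smul, inv_mul_cancel₀ h2, one_smul] at h3
    -- all `e_j ∈ W`
    have hall : ∀ j : Fin 3, (Pi.single j 1 : Fin 3 → ZMod 3) ∈ W.toSubmodule := by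
      have neg_iff : ∀ w : Fin 3 → ZMod 3, -w ∈ W.toSubmodule → w ∈ W.toSubmodule :=
        fun w hw => by simpa using W.toSubmodule.neg_mem hw
      have from0 : (Pi.single 0 1 : Fin 3 → ZMod 3) ∈ W.toSubmodule →
          (Pi.single 2 1 : Fin 3 → ZMod 3) ∈ W.toSubmodule := fun h0 =>
        neg_iff _ (by rw [← hC0]; exact hmem genC genC_mem _ h0)
      have from2a : (Pi.single 2 1 : Fin 3 → ZMod 3) ∈ W.toSubmodule →
          (Pi.single 1 1 : Fin 3 → ZMod 3) ∈ W.toSubmodule := fun h2 =>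
        neg_iff _ (by rw [← hT2]; exact hmem genT genT_mem _ h2)
      have from2b : (Pi.single 2 1 : Fin 3 → ZMod 3) ∈ W.toSubmodule →
          (Pi.single 0 1 : Fin 3 → ZMod 3) ∈ W.toSubmodule := fun h2 => by
        rw [← hC2]; exact hmem genC genC_mem _ h2
      have from1 : (Pi.single 1 1 : Fin 3 → ZMod 3) ∈ W.toSubmodule →
          (Pi.single 2 1 : Fin 3 → ZMod 3) ∈ W.toSubmodule := fun h1 =>
        neg_iff _ (by rw [← hT1]; exact hmem genT genT_mem _ h1)
      have h2 : (Pi.single 2 1 : Fin 3 → ZMod 3) ∈ W.toSubmodule := by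
        fin_cases i
        · exact from0 hei
        · exact from1 hei
        · exact hei
      intro j
      fin_cases j
      · exact from2b h2
      · exact from2a h2
      · exact h2
    apply Subrepresentation.toSubmodule_injective
    change W.toSubmodule = ⊤
    rw [eq_top_iff]
    rintro w -
    rw [← Finset.univ_sum_single w]
    refine W.toSubmodule.sum_mem fun j _ => ?_
    have h := W.toSubmodule.smul_mem (w j) (hall j)
    rw [← Pi.single_smul, smul_eq_mul, mul_one] at h
    exact h

/-- The double transposition `(1 2)(3 4) = (1 2) · (3 4)` with `(3 4) = (1 3)(2 4) (1 2) (1 3)(2 4)`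
lies in `S₄`. [folklore] -/
theorem diag_mem : genT * (genC ^ 2 * genT * genC ^ 2) ∈ s4Image :=
  s4Image.mul_mem genT_mem (s4Image.mul_mem (s4Image.mul_mem (s4Image.pow_mem genC_mem 2)
    genT_mem) (s4Image.pow_mem genC_mem 2))

/-- `(1 2)(3 4)` acts diagonally, `diag(1, −1, −1)`, in the pairing basis. [folklore] -/
theorem coe_diag : ((genT * (genC ^ 2 * genT * genC ^ 2) : GL (Fin 3) (ZMod 3)) :
    Matrix (Fin 3) (Fin 3) (ZMod 3)) = Matrix.diagonal ![1, -1, -1] := by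
  decide

/-- **The `S₄` branch-point module over `𝔽₃` is adequate in the extended sense** — the instance
`G = S₄`, `V = 𝔽₃⁴/Δ`, `p = 3 = dim V` of GHT 2017, Theorem 1.7, settled by its imprimitive case
Prop. 6.6 (`Subgroup.isExtendedAdequate_of_lines`): `S₄ = V₄ ⋊ S₃` permutes the three pairing
lines, `(1 2)(3 4) ∈ V₄ = A` is diagonal with the two eigenvalues `±1`, and `(1 2)` fixes the
pairing `{12|34}` while moving `{13|24}` (`|G/A| = 6 ≠ 3`).  This is the residual image wanted for
Thorne's minimal lifting theorem on generic Picard curves (work item wi-37170).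
[cite: GuralnickHerzigTiep2017, Proposition 6.6 (instance); Theorem 1.7] -/
theorem s4Image_isExtendedAdequate : Subgroup.IsExtendedAdequate s4Image := by
  refine Subgroup.isExtendedAdequate_of_lines s4Image isIrreducible (Pi.basisFun (ZMod 3) (Fin 3))
    ?_ ?_ ?_
  · intro h i
    obtain ⟨j, c, hj⟩ := exists_mulVec_single_eq h.1 h.2 i
    exact ⟨j, c, by rw [Pi.basisFun_apply, Pi.basisFun_apply]; exact hj⟩
  · refine ⟨⟨_, diag_mem⟩, ![1, -1, -1], fun i => ?_, 0, 1, by decide⟩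
    change ((genT * (genC ^ 2 * genT * genC ^ 2) : GL (Fin 3) (ZMod 3)) :
      Matrix (Fin 3) (Fin 3) (ZMod 3)) *ᵥ Pi.basisFun (ZMod 3) (Fin 3) i = _
    rw [coe_diag, Pi.basisFun_apply]
    fin_cases i <;> decide
  · refine ⟨⟨genT, genT_mem⟩, 0, 1, ⟨1, ?_⟩, fun c => ?_⟩
    · change (genT : Matrix (Fin 3) (Fin 3) (ZMod 3)) *ᵥ Pi.basisFun (ZMod 3) (Fin 3) 0 =
        (1 : ZMod 3) • Pi.basisFun (ZMod 3) (Fin 3) 0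
      rw [Pi.basisFun_apply]
      decide
    change (genT : Matrix (Fin 3) (Fin 3) (ZMod 3)) *ᵥ Pi.basisFun (ZMod 3) (Fin 3) 1 ≠
      c • Pi.basisFun (ZMod 3) (Fin 3) 1
    rw [Pi.basisFun_apply]
    fin_cases c <;> decide

end S4BranchModule

end Literature.NumberTheory.GaloisRepresentations
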